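/- Width seat 2/3 `ym-line-cbag-p1-w2` (prover-ym-line-cbag-p1-w2-g20-0) of the cell of ideator ym-idea-2, LINE 8
(route `EguchiKawaiDirectionLadder`), post-closure glue for the barrier entry `EguchiKawaiBreakdown`: LARGE-`N` FACTORISATION of
the Wilson words of the Eguchi–Kawai single-site model at strong coupling, in the model's own expectation `⟨·⟩_EK`
(variances `O(1/N²)`, covariances `O(1/N²)`).  Route-independent; YM mass gap NOT touched (barrier-ledger line). -/
import Summits.QuantumFields.YangMills.Theorems.EguchiKawaiDirectionLadderWilsonWords
import HarnessLib

/-!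
# Large-`N` factorisation of Wilson words in the Eguchi–Kawai model at strong coupling

`EguchiKawaiDirectionLadderWilsonWords.lean` proves the Poincaré inequalities `ek_poincare_wordRe/Im` for every word
`W_l = (1/N) tr V_{μ₁}^{ε₁} ⋯ V_{μ_k}^{ε_k}` of the `SU(N)` single-site model at strong coupling (`16(d−1)|b| < 1`).  This file
turns them into statements about the normalised Gibbs expectation `⟨F⟩ = ekExpectationSU N b F` (Makeenko (14.43)):

* `ekExpectationSU_var_wordRe_le / _wordIm_le` : `⟨(Re W_l − ⟨Re W_l⟩)²⟩ ≤ (M(l)/N)/(N/2 − 8(d−1)N|b|)`, `M(l) = Σ_μ m_μ²`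
  (`m_μ` the multiplicity of the direction `μ` in `l`) — for EVERY word, closed or open, every `d`, every `N ≥ 1`;
* `tendsto_ekExpectationSU_var_wordRe / _wordIm` : hence the variances tend to `0` as `N → ∞` (self-averaging of every word);
* `abs_ekExpectationSU_mul_sub_mul_le` (Cauchy–Schwarz for `⟨·⟩`) : `|⟨FG⟩ − ⟨F⟩⟨G⟩| ≤ √⟨(F−⟨F⟩)²⟩ √⟨(G−⟨G⟩)²⟩` for
  continuous observables;
* `ek_factorisation_wordRe` : **large-`N` factorisation** `|⟨Re W_l · Re W_{l'}⟩ − ⟨Re W_l⟩⟨Re W_{l'}⟩| ≤ √(M(l)M(l')) / (N (N/2 − 8(d−1)N|b|))`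
  and its `N → ∞` limit `tendsto_ek_factorisation_wordRe` (likewise `Im/Im`, `Re/Im`) — the factorisation property of the
  large-`N` limit (Makeenko §11.6, (12.61); used with (14.51) to close the reduced loop equation (14.50)) as a THEOREM for the
  single-site model at strong coupling.

HONEST FRAMING.  Statements about the `SU(N)` single-site integral at STRONG coupling (`16(d−1)|b| < 1`); by w4's transfer the
`U(N)` model has the same expectations for phase-invariant observables (e.g. real parts of CLOSED words), not done here.  Nothing
about the `N = ∞` reduction itself, the lattice theory, or the Yang–Mills mass gap / the summit `YangMills` is proved or advanced.

References: Y. Makeenko, *Methods of Contemporary Gauge Theory* (2023) §11.6, §14.3 (14.43)–(14.51); H. Shen, R. Zhu, X. Zhu,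
CMP 400 (2023) Cor. 1.8 (large-`N` factorisation of lattice Yang–Mills at strong coupling, the lattice analogue).
-/

set_option autoImplicit false

noncomputable section

open scoped Matrix ComplexConjugate BigOperators
open Matrix Complex Finset MeasureTheory Filter Topology
open Literature.Barriers.QuantumFields (EKConfigSU ekHaarSU inclSU ekWeight ekExpectationSU continuous_ekWeight
  continuous_inclSU isProbabilityMeasure_ekHaarSU ekPartitionSU_pos)

namespace Summit.QuantumFields.YangMills.Theorems.EguchiKawaiDirectionLadder

variable {d N : ℕ}

/-! ## From the Poincaré inequality to the variance of `⟨·⟩_EK` -/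

/-- Continuous observables are integrable against `∏ dV_μ` (compact configuration space). -/
theorem integrable_of_continuous_EKSU {f : EKConfigSU d N → ℝ} (hf : Continuous f) :
    Integrable f (ekHaarSU d N) := by
  haveI : IsProbabilityMeasure (ekHaarSU d N) := isProbabilityMeasure_ekHaarSU d N
  exact hf.integrable_of_hasCompactSupport (HasCompactSupport.of_compactSpace _)

/-- The Gibbs mean written with the weight on the left: `⟨u⟩ = (∫ w u) / (∫ w)`. -/
theorem ekExpectationSU_eq_weight_left (b : ℝ) (u : EKConfigSU d N → ℝ) :
    ekExpectationSU N b u =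
      (∫ V, ekWeight N b (inclSU V) * u V ∂ekHaarSU d N) / (∫ V, ekWeight N b (inclSU V) ∂ekHaarSU d N) := by
  unfold ekExpectationSU
  congr 1
  exact integral_congr_ae (Eventually.of_forall fun V => mul_comm _ _)

/-- **Poincaré ⇒ variance bound for `⟨·⟩_EK`**: if `K ∫ w (u − (∫ w u)/(∫ w))² ≤ C ∫ w` with `K > 0`, then
`⟨(u − ⟨u⟩)²⟩ ≤ C / K`. -/
theorem ekExpectationSU_var_le_of_poincare (b : ℝ) (u : EKConfigSU d N → ℝ) {K C : ℝ} (hK : 0 < K)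
    (h : K * ∫ V, ekWeight N b (inclSU V) * (u V -
        (∫ V, ekWeight N b (inclSU V) * u V ∂ekHaarSU d N) / (∫ V, ekWeight N b (inclSU V) ∂ekHaarSU d N)) ^ 2
          ∂ekHaarSU d N ≤ C * ∫ V, ekWeight N b (inclSU V) ∂ekHaarSU d N) :
    ekExpectationSU N b (fun V => (u V - ekExpectationSU N b u) ^ 2) ≤ C / K := by
  have hZ := ekPartitionSU_pos d N b
  rw [ekExpectationSU_eq_weight_left b (fun V => (u V - ekExpectationSU N b u) ^ 2), ekExpectationSU_eq_weight_left b u,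
    div_le_iff₀ hZ, div_mul_eq_mul_div, le_div_iff₀ hK]
  calc (∫ V, ekWeight N b (inclSU V) * (u V -
        (∫ V, ekWeight N b (inclSU V) * u V ∂ekHaarSU d N) / (∫ V, ekWeight N b (inclSU V) ∂ekHaarSU d N)) ^ 2
          ∂ekHaarSU d N) * K
      = K * ∫ V, ekWeight N b (inclSU V) * (u V -
        (∫ V, ekWeight N b (inclSU V) * u V ∂ekHaarSU d N) / (∫ V, ekWeight N b (inclSU V) ∂ekHaarSU d N)) ^ 2
          ∂ekHaarSU d N := mul_comm _ _
    _ ≤ C * ∫ V, ekWeight N b (inclSU V) ∂ekHaarSU d N := h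

/-- **Variance of every Wilson word, real part**: `⟨(Re W_l − ⟨Re W_l⟩)²⟩_{SU(N)} ≤ (M(l)/N)/(N/2 − 8(d−1)N|b|)` for
`16(d−1)|b| < 1`, `N ≥ 1`, every `d` and every word `l` (closed or open). -/
theorem ekExpectationSU_var_wordRe_le (hN : N ≠ 0) {b : ℝ} (hb : 16 * ((d : ℝ) - 1) * |b| < 1) (l : List (Fin d × Bool)) :
    ekExpectationSU N b (fun V : EKConfigSU d N => ((ekWord l (inclSU V)).re -
        ekExpectationSU N b (fun V => (ekWord l (inclSU V)).re)) ^ 2) ≤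
      ((∑ μ : Fin d, (wordMult l μ : ℝ) ^ 2) / N) / ((N : ℝ) / 2 - 8 * ((d : ℝ) - 1) * N * |b|) :=
  ekExpectationSU_var_le_of_poincare b _ (ekCurvature_pos hN hb) (ek_poincare_wordRe hN hb l)

/-- **Variance of every Wilson word, imaginary part** (as `ekExpectationSU_var_wordRe_le`). -/
theorem ekExpectationSU_var_wordIm_le (hN : N ≠ 0) {b : ℝ} (hb : 16 * ((d : ℝ) - 1) * |b| < 1) (l : List (Fin d × Bool)) :
    ekExpectationSU N b (fun V : EKConfigSU d N => ((ekWord l (inclSU V)).im -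
        ekExpectationSU N b (fun V => (ekWord l (inclSU V)).im)) ^ 2) ≤
      ((∑ μ : Fin d, (wordMult l μ : ℝ) ^ 2) / N) / ((N : ℝ) / 2 - 8 * ((d : ℝ) - 1) * N * |b|) :=
  ekExpectationSU_var_le_of_poincare b _ (ekCurvature_pos hN hb) (ek_poincare_wordIm hN hb l)

/-- Expectations of non-negative observables are non-negative. -/
theorem ekExpectationSU_nonneg (b : ℝ) {F : EKConfigSU d N → ℝ} (hF : ∀ V, 0 ≤ F V) : 0 ≤ ekExpectationSU N b F := by
  unfold ekExpectationSU
  exact div_nonneg (integral_nonneg fun V => mul_nonneg (hF V) (Real.exp_pos _).le) (ekPartitionSU_pos d N b).le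

/-- The variance bound `(M/N)/(N/2 − 8(d−1)N|b|) = M / (N² (1/2 − 8(d−1)|b|))` tends to zero. -/
theorem tendsto_wordVarBound {b : ℝ} (hb : 16 * ((d : ℝ) - 1) * |b| < 1) (M : ℝ) :
    Tendsto (fun N : ℕ => (M / N) / ((N : ℝ) / 2 - 8 * ((d : ℝ) - 1) * N * |b|)) atTop (𝓝 0) := by
  set κ : ℝ := 1 / 2 - 8 * ((d : ℝ) - 1) * |b| with hκ
  have hκpos : 0 < κ := by rw [hκ]; nlinarith [abs_nonneg b]
  have hlim : Tendsto (fun N : ℕ => (M / κ) * ((N : ℝ) ^ 2)⁻¹) atTop (𝓝 0) := by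
    have h1 : Tendsto (fun N : ℕ => (N : ℝ) ^ 2) atTop atTop :=
      (tendsto_pow_atTop two_ne_zero).comp tendsto_natCast_atTop_atTop
    simpa using h1.inv_tendsto_atTop.const_mul (M / κ)
  refine hlim.congr' ?_
  filter_upwards [eventually_gt_atTop 0] with N hN
  have hNr : (0 : ℝ) < N := by exact_mod_cast hN
  rw [hκ]
  field_simp

/-- **Self-averaging of every word, real part**: `⟨(Re W_l − ⟨Re W_l⟩)²⟩_{SU(N)} → 0` as `N → ∞` at strong coupling. -/
theorem tendsto_ekExpectationSU_var_wordRe {b : ℝ} (hb : 16 * ((d : ℝ) - 1) * |b| < 1) (l : List (Fin d × Bool)) :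
    Tendsto (fun N : ℕ => ekExpectationSU N b (fun V : EKConfigSU d N => ((ekWord l (inclSU V)).re -
        ekExpectationSU N b (fun V => (ekWord l (inclSU V)).re)) ^ 2)) atTop (𝓝 0) := by
  refine tendsto_of_tendsto_of_tendsto_of_le_of_le' tendsto_const_nhds
    (tendsto_wordVarBound hb (∑ μ : Fin d, (wordMult l μ : ℝ) ^ 2)) ?_ ?_
  · exact Eventually.of_forall fun N => ekExpectationSU_nonneg b fun V => sq_nonneg _
  · filter_upwards [eventually_gt_atTop 0] with N hN
    exact ekExpectationSU_var_wordRe_le (Nat.pos_iff_ne_zero.1 hN) hb l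

/-- **Self-averaging of every word, imaginary part**: `⟨(Im W_l − ⟨Im W_l⟩)²⟩_{SU(N)} → 0` as `N → ∞` at strong coupling. -/
theorem tendsto_ekExpectationSU_var_wordIm {b : ℝ} (hb : 16 * ((d : ℝ) - 1) * |b| < 1) (l : List (Fin d × Bool)) :
    Tendsto (fun N : ℕ => ekExpectationSU N b (fun V : EKConfigSU d N => ((ekWord l (inclSU V)).im -
        ekExpectationSU N b (fun V => (ekWord l (inclSU V)).im)) ^ 2)) atTop (𝓝 0) := by
  refine tendsto_of_tendsto_of_tendsto_of_le_of_le' tendsto_const_nhds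
    (tendsto_wordVarBound hb (∑ μ : Fin d, (wordMult l μ : ℝ) ^ 2)) ?_ ?_
  · exact Eventually.of_forall fun N => ekExpectationSU_nonneg b fun V => sq_nonneg _
  · filter_upwards [eventually_gt_atTop 0] with N hN
    exact ekExpectationSU_var_wordIm_le (Nat.pos_iff_ne_zero.1 hN) hb l

/-! ## Cauchy–Schwarz for the Gibbs expectation and factorisation of products -/

/-- **Weighted Cauchy–Schwarz** on the configuration space: for continuous `X`, `Y` and the weight `w = e^{−N² b S_R} ≥ 0`,
`|∫ w X Y| ≤ (∫ w X²)^{1/2} (∫ w Y²)^{1/2}` (AM–GM `2|XY| ≤ tX² + Y²/t` and optimisation in `t`). -/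
theorem abs_integral_weight_mul_mul_le (b : ℝ) {X Y : EKConfigSU d N → ℝ} (hX : Continuous X) (hY : Continuous Y) :
    |∫ V, ekWeight N b (inclSU V) * (X V * Y V) ∂ekHaarSU d N| ≤
      Real.sqrt (∫ V, ekWeight N b (inclSU V) * X V ^ 2 ∂ekHaarSU d N) *
        Real.sqrt (∫ V, ekWeight N b (inclSU V) * Y V ^ 2 ∂ekHaarSU d N) := by
  set μ := ekHaarSU d N
  have hw : Continuous fun V : EKConfigSU d N => ekWeight N b (inclSU V) := (continuous_ekWeight N b).comp continuous_inclSU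
  have hw0 : ∀ V : EKConfigSU d N, 0 ≤ ekWeight N b (inclSU V) := fun V => (Real.exp_pos _).le
  set A := ∫ V, ekWeight N b (inclSU V) * X V ^ 2 ∂μ with hA
  set B := ∫ V, ekWeight N b (inclSU V) * Y V ^ 2 ∂μ with hB
  have hA0 : 0 ≤ A := integral_nonneg fun V => mul_nonneg (hw0 V) (sq_nonneg _)
  have hB0 : 0 ≤ B := integral_nonneg fun V => mul_nonneg (hw0 V) (sq_nonneg _)
  have iA : Integrable (fun V => ekWeight N b (inclSU V) * X V ^ 2) μ := integrable_of_continuous_EKSU (hw.mul (hX.pow 2))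
  have iB : Integrable (fun V => ekWeight N b (inclSU V) * Y V ^ 2) μ := integrable_of_continuous_EKSU (hw.mul (hY.pow 2))
  have iXY : Integrable (fun V => ekWeight N b (inclSU V) * (X V * Y V)) μ :=
    integrable_of_continuous_EKSU (hw.mul (hX.mul hY))
  -- AM–GM for every `t > 0`
  have hamgm : ∀ t : ℝ, 0 < t → 2 * |∫ V, ekWeight N b (inclSU V) * (X V * Y V) ∂μ| ≤ t * A + B / t := by
    intro t ht
    calc 2 * |∫ V, ekWeight N b (inclSU V) * (X V * Y V) ∂μ|
        ≤ 2 * ∫ V, |ekWeight N b (inclSU V) * (X V * Y V)| ∂μ := by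
          have := abs_integral_le_integral_abs (f := fun V => ekWeight N b (inclSU V) * (X V * Y V)) (μ := μ)
          linarith
      _ = ∫ V, 2 * |ekWeight N b (inclSU V) * (X V * Y V)| ∂μ := (integral_const_mul _ _).symm
      _ ≤ ∫ V, (t * (ekWeight N b (inclSU V) * X V ^ 2) + ekWeight N b (inclSU V) * Y V ^ 2 / t) ∂μ := by
          refine integral_mono (iXY.abs.const_mul 2) ((iA.const_mul t).add (iB.div_const t)) fun V => ?_
          have h2 : 2 * |X V * Y V| ≤ t * X V ^ 2 + Y V ^ 2 / t := by
            rw [abs_mul, ← sq_abs (X V), ← sq_abs (Y V)]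
            have hsq := sq_nonneg (t * |X V| - |Y V|)
            have e : t * |X V| ^ 2 + |Y V| ^ 2 / t - 2 * (|X V| * |Y V|) = (t * |X V| - |Y V|) ^ 2 / t := by
              field_simp
              ring
            have := div_nonneg hsq ht.le
            linarith
          rw [abs_mul, abs_of_nonneg (hw0 V)]
          have := mul_le_mul_of_nonneg_left h2 (hw0 V)
          calc 2 * (ekWeight N b (inclSU V) * |X V * Y V|) = ekWeight N b (inclSU V) * (2 * |X V * Y V|) := by ring
            _ ≤ ekWeight N b (inclSU V) * (t * X V ^ 2 + Y V ^ 2 / t) := this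
            _ = t * (ekWeight N b (inclSU V) * X V ^ 2) + ekWeight N b (inclSU V) * Y V ^ 2 / t := by ring
      _ = t * A + B / t := by
          rw [integral_add (iA.const_mul t) (iB.div_const t), integral_const_mul, integral_div]
  -- degenerate cases
  by_cases hA1 : A = 0
  · have hX0 : (fun V => ekWeight N b (inclSU V) * X V ^ 2) =ᵐ[μ] 0 :=
      (integral_eq_zero_iff_of_nonneg (fun V => mul_nonneg (hw0 V) (sq_nonneg _)) iA).1 hA1
    have hXY0 : (fun V => ekWeight N b (inclSU V) * (X V * Y V)) =ᵐ[μ] 0 := hX0.mono fun V hV => by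
      have hV' : ekWeight N b (inclSU V) * X V ^ 2 = 0 := hV
      rcases mul_eq_zero.1 hV' with h | h
      · simp [h]
      · have : X V = 0 := pow_eq_zero_iff (n := 2) (by norm_num) |>.1 h
        simp [this]
    rw [integral_congr_ae hXY0]
    simp only [Pi.zero_apply, integral_zero, abs_zero]
    positivity
  by_cases hB1 : B = 0
  · have hY0 : (fun V => ekWeight N b (inclSU V) * Y V ^ 2) =ᵐ[μ] 0 :=
      (integral_eq_zero_iff_of_nonneg (fun V => mul_nonneg (hw0 V) (sq_nonneg _)) iB).1 hB1
    have hXY0 : (fun V => ekWeight N b (inclSU V) * (X V * Y V)) =ᵐ[μ] 0 := hY0.mono fun V hV => by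
      have hV' : ekWeight N b (inclSU V) * Y V ^ 2 = 0 := hV
      rcases mul_eq_zero.1 hV' with h | h
      · simp [h]
      · have : Y V = 0 := pow_eq_zero_iff (n := 2) (by norm_num) |>.1 h
        simp [this]
    rw [integral_congr_ae hXY0]
    simp only [Pi.zero_apply, integral_zero, abs_zero]
    positivity
  -- optimise `t = √B/√A`
  have hApos : 0 < A := lt_of_le_of_ne hA0 (Ne.symm hA1)
  have hBpos : 0 < B := lt_of_le_of_ne hB0 (Ne.symm hB1)
  have hsA : 0 < Real.sqrt A := Real.sqrt_pos.2 hApos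
  have hsB : 0 < Real.sqrt B := Real.sqrt_pos.2 hBpos
  have h := hamgm (Real.sqrt B / Real.sqrt A) (div_pos hsB hsA)
  have hAA : A = Real.sqrt A * Real.sqrt A := (Real.mul_self_sqrt hA0).symm
  have hBB : B = Real.sqrt B * Real.sqrt B := (Real.mul_self_sqrt hB0).symm
  have e1 : Real.sqrt B / Real.sqrt A * A = Real.sqrt A * Real.sqrt B := by
    calc Real.sqrt B / Real.sqrt A * A = Real.sqrt B / Real.sqrt A * (Real.sqrt A * Real.sqrt A) := by rw [← hAA]
      _ = Real.sqrt A * Real.sqrt B := by field_simp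
  have e2 : B / (Real.sqrt B / Real.sqrt A) = Real.sqrt A * Real.sqrt B := by
    calc B / (Real.sqrt B / Real.sqrt A) = Real.sqrt B * Real.sqrt B / (Real.sqrt B / Real.sqrt A) := by rw [← hBB]
      _ = Real.sqrt A * Real.sqrt B := by field_simp
  rw [e1, e2] at h
  linarith

/-- **Cauchy–Schwarz for the Gibbs expectation (covariance bound)**: for continuous observables `F`, `G`,
`|⟨FG⟩ − ⟨F⟩⟨G⟩| ≤ √⟨(F − ⟨F⟩)²⟩ · √⟨(G − ⟨G⟩)²⟩` (`⟨·⟩ = ekExpectationSU N b`). -/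
theorem abs_ekExpectationSU_mul_sub_mul_le (b : ℝ) {F G : EKConfigSU d N → ℝ} (hF : Continuous F) (hG : Continuous G) :
    |ekExpectationSU N b (fun V => F V * G V) - ekExpectationSU N b F * ekExpectationSU N b G| ≤
      Real.sqrt (ekExpectationSU N b (fun V => (F V - ekExpectationSU N b F) ^ 2)) *
        Real.sqrt (ekExpectationSU N b (fun V => (G V - ekExpectationSU N b G) ^ 2)) := by
  set μ := ekHaarSU d N
  set Z := ∫ V, ekWeight N b (inclSU V) ∂μ with hZdef
  have hZ : 0 < Z := ekPartitionSU_pos d N b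
  set mF := ekExpectationSU N b F with hmF
  set mG := ekExpectationSU N b G with hmG
  have hw : Continuous fun V : EKConfigSU d N => ekWeight N b (inclSU V) := (continuous_ekWeight N b).comp continuous_inclSU
  -- `∫ w F = mF Z`, `∫ w G = mG Z`
  have hIF : ∫ V, ekWeight N b (inclSU V) * F V ∂μ = mF * Z := by
    rw [hmF, ekExpectationSU_eq_weight_left, div_mul_cancel₀ _ hZ.ne']
  have hIG : ∫ V, ekWeight N b (inclSU V) * G V ∂μ = mG * Z := by
    rw [hmG, ekExpectationSU_eq_weight_left, div_mul_cancel₀ _ hZ.ne']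
  -- the centred product
  have hcen : ∫ V, ekWeight N b (inclSU V) * ((F V - mF) * (G V - mG)) ∂μ =
      ∫ V, ekWeight N b (inclSU V) * (F V * G V) ∂μ - mF * mG * Z := by
    have i1 : Integrable (fun V => ekWeight N b (inclSU V) * (F V * G V)) μ := integrable_of_continuous_EKSU (hw.mul (hF.mul hG))
    have i2 : Integrable (fun V => mG * (ekWeight N b (inclSU V) * F V)) μ :=
      (integrable_of_continuous_EKSU (hw.mul hF)).const_mul _
    have i3 : Integrable (fun V => mF * (ekWeight N b (inclSU V) * G V)) μ :=
      (integrable_of_continuous_EKSU (hw.mul hG)).const_mul _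
    have i4 : Integrable (fun V => mF * mG * ekWeight N b (inclSU V)) μ := (integrable_of_continuous_EKSU hw).const_mul _
    have e : (fun V => ekWeight N b (inclSU V) * ((F V - mF) * (G V - mG))) =
        fun V => ekWeight N b (inclSU V) * (F V * G V) - mG * (ekWeight N b (inclSU V) * F V)
          - mF * (ekWeight N b (inclSU V) * G V) + mF * mG * ekWeight N b (inclSU V) := by
      funext V; ring
    have i12 : Integrable (fun V => ekWeight N b (inclSU V) * (F V * G V) - mG * (ekWeight N b (inclSU V) * F V)) μ :=
      i1.sub i2
    have i123 : Integrable (fun V => ekWeight N b (inclSU V) * (F V * G V) - mG * (ekWeight N b (inclSU V) * F V)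
        - mF * (ekWeight N b (inclSU V) * G V)) μ := i12.sub i3
    rw [e, integral_add i123 i4, integral_sub i12 i3, integral_sub i1 i2, integral_const_mul,
      integral_const_mul, integral_const_mul, hIF, hIG]
    ring
  -- rewrite everything through `Z`
  have hprod : ekExpectationSU N b (fun V => F V * G V) - mF * mG =
      (∫ V, ekWeight N b (inclSU V) * ((F V - mF) * (G V - mG)) ∂μ) / Z := by
    rw [hcen, ekExpectationSU_eq_weight_left, sub_div, mul_div_cancel_right₀ _ hZ.ne']
  have hvarF : ekExpectationSU N b (fun V => (F V - mF) ^ 2) = (∫ V, ekWeight N b (inclSU V) * (F V - mF) ^ 2 ∂μ) / Z :=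
    ekExpectationSU_eq_weight_left b _
  have hvarG : ekExpectationSU N b (fun V => (G V - mG) ^ 2) = (∫ V, ekWeight N b (inclSU V) * (G V - mG) ^ 2 ∂μ) / Z :=
    ekExpectationSU_eq_weight_left b _
  rw [hprod, hvarF, hvarG, abs_div, abs_of_pos hZ, Real.sqrt_div' _ hZ.le, Real.sqrt_div' _ hZ.le,
    div_mul_div_comm, Real.mul_self_sqrt hZ.le, div_le_div_iff_of_pos_right hZ]
  exact abs_integral_weight_mul_mul_le b (hF.sub continuous_const) (hG.sub continuous_const)

/-- The real part of a word is a continuous observable on `SU(N)^d`. -/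
theorem continuous_wordRe_inclSU (l : List (Fin d × Bool)) :
    Continuous fun V : EKConfigSU d N => (ekWord l (inclSU V)).re :=
  Complex.continuous_re.comp ((continuous_ekWord l).comp continuous_inclSU)

/-- The imaginary part of a word is a continuous observable on `SU(N)^d`. -/
theorem continuous_wordIm_inclSU (l : List (Fin d × Bool)) :
    Continuous fun V : EKConfigSU d N => (ekWord l (inclSU V)).im :=
  Complex.continuous_im.comp ((continuous_ekWord l).comp continuous_inclSU)

/-- `√a √a' ≤ ...`: the product of the two variance bounds is the factorisation bound. -/
theorem sqrt_varBound_mul_sqrt_varBound {M M' K : ℝ} (hM : 0 ≤ M) (hK : 0 < K) (hNr : (0 : ℝ) < N) :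
    Real.sqrt ((M / N) / K) * Real.sqrt ((M' / N) / K) = Real.sqrt (M * M') / (N * K) := by
  rw [← Real.sqrt_mul (by positivity), show M / N / K * (M' / N / K) = (M * M') / ((N * K) ^ 2) by field_simp,
    Real.sqrt_div' _ (sq_nonneg _), Real.sqrt_sq (by positivity)]

/-- **Large-`N` factorisation of Wilson words at strong coupling (real parts)**: for `16(d−1)|b| < 1`, `N ≥ 1` and any two
words `l`, `l'`,
`|⟨Re W_l · Re W_{l'}⟩ − ⟨Re W_l⟩ ⟨Re W_{l'}⟩| ≤ √(M(l) M(l')) / (N (N/2 − 8(d−1)N|b|)) = O(k k'/N²)`. -/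
theorem ek_factorisation_wordRe (hN : N ≠ 0) {b : ℝ} (hb : 16 * ((d : ℝ) - 1) * |b| < 1) (l l' : List (Fin d × Bool)) :
    |ekExpectationSU N b (fun V : EKConfigSU d N => (ekWord l (inclSU V)).re * (ekWord l' (inclSU V)).re) -
        ekExpectationSU N b (fun V => (ekWord l (inclSU V)).re) * ekExpectationSU N b (fun V => (ekWord l' (inclSU V)).re)| ≤
      Real.sqrt ((∑ μ : Fin d, (wordMult l μ : ℝ) ^ 2) * (∑ μ : Fin d, (wordMult l' μ : ℝ) ^ 2)) /
        (N * ((N : ℝ) / 2 - 8 * ((d : ℝ) - 1) * N * |b|)) := by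
  have hK := ekCurvature_pos (N := N) hN hb (d := d)
  have hNr : (0 : ℝ) < N := by exact_mod_cast Nat.pos_of_ne_zero hN
  refine (abs_ekExpectationSU_mul_sub_mul_le b (continuous_wordRe_inclSU l) (continuous_wordRe_inclSU l')).trans ?_
  rw [← sqrt_varBound_mul_sqrt_varBound (M' := ∑ μ : Fin d, (wordMult l' μ : ℝ) ^ 2)
    (sum_nonneg fun μ _ => sq_nonneg _) hK hNr]
  exact mul_le_mul (Real.sqrt_le_sqrt (ekExpectationSU_var_wordRe_le hN hb l))
    (Real.sqrt_le_sqrt (ekExpectationSU_var_wordRe_le hN hb l')) (Real.sqrt_nonneg _) (Real.sqrt_nonneg _)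

/-- **Large-`N` factorisation, imaginary parts** (as `ek_factorisation_wordRe`). -/
theorem ek_factorisation_wordIm (hN : N ≠ 0) {b : ℝ} (hb : 16 * ((d : ℝ) - 1) * |b| < 1) (l l' : List (Fin d × Bool)) :
    |ekExpectationSU N b (fun V : EKConfigSU d N => (ekWord l (inclSU V)).im * (ekWord l' (inclSU V)).im) -
        ekExpectationSU N b (fun V => (ekWord l (inclSU V)).im) * ekExpectationSU N b (fun V => (ekWord l' (inclSU V)).im)| ≤
      Real.sqrt ((∑ μ : Fin d, (wordMult l μ : ℝ) ^ 2) * (∑ μ : Fin d, (wordMult l' μ : ℝ) ^ 2)) /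
        (N * ((N : ℝ) / 2 - 8 * ((d : ℝ) - 1) * N * |b|)) := by
  have hK := ekCurvature_pos (N := N) hN hb (d := d)
  have hNr : (0 : ℝ) < N := by exact_mod_cast Nat.pos_of_ne_zero hN
  refine (abs_ekExpectationSU_mul_sub_mul_le b (continuous_wordIm_inclSU l) (continuous_wordIm_inclSU l')).trans ?_
  rw [← sqrt_varBound_mul_sqrt_varBound (M' := ∑ μ : Fin d, (wordMult l' μ : ℝ) ^ 2)
    (sum_nonneg fun μ _ => sq_nonneg _) hK hNr]
  exact mul_le_mul (Real.sqrt_le_sqrt (ekExpectationSU_var_wordIm_le hN hb l))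
    (Real.sqrt_le_sqrt (ekExpectationSU_var_wordIm_le hN hb l')) (Real.sqrt_nonneg _) (Real.sqrt_nonneg _)

/-- **Large-`N` factorisation, mixed** (`Re W_l` against `Im W_{l'}`). -/
theorem ek_factorisation_wordRe_wordIm (hN : N ≠ 0) {b : ℝ} (hb : 16 * ((d : ℝ) - 1) * |b| < 1)
    (l l' : List (Fin d × Bool)) :
    |ekExpectationSU N b (fun V : EKConfigSU d N => (ekWord l (inclSU V)).re * (ekWord l' (inclSU V)).im) -
        ekExpectationSU N b (fun V => (ekWord l (inclSU V)).re) * ekExpectationSU N b (fun V => (ekWord l' (inclSU V)).im)| ≤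
      Real.sqrt ((∑ μ : Fin d, (wordMult l μ : ℝ) ^ 2) * (∑ μ : Fin d, (wordMult l' μ : ℝ) ^ 2)) /
        (N * ((N : ℝ) / 2 - 8 * ((d : ℝ) - 1) * N * |b|)) := by
  have hK := ekCurvature_pos (N := N) hN hb (d := d)
  have hNr : (0 : ℝ) < N := by exact_mod_cast Nat.pos_of_ne_zero hN
  refine (abs_ekExpectationSU_mul_sub_mul_le b (continuous_wordRe_inclSU l) (continuous_wordIm_inclSU l')).trans ?_
  rw [← sqrt_varBound_mul_sqrt_varBound (M' := ∑ μ : Fin d, (wordMult l' μ : ℝ) ^ 2)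
    (sum_nonneg fun μ _ => sq_nonneg _) hK hNr]
  exact mul_le_mul (Real.sqrt_le_sqrt (ekExpectationSU_var_wordRe_le hN hb l))
    (Real.sqrt_le_sqrt (ekExpectationSU_var_wordIm_le hN hb l')) (Real.sqrt_nonneg _) (Real.sqrt_nonneg _)

/-- **Factorisation in the large-`N` limit**: `⟨Re W_l Re W_{l'}⟩ − ⟨Re W_l⟩⟨Re W_{l'}⟩ → 0` as `N → ∞` at strong coupling,
for any two words. -/
theorem tendsto_ek_factorisation_wordRe {b : ℝ} (hb : 16 * ((d : ℝ) - 1) * |b| < 1) (l l' : List (Fin d × Bool)) :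
    Tendsto (fun N : ℕ => ekExpectationSU N b (fun V : EKConfigSU d N => (ekWord l (inclSU V)).re * (ekWord l' (inclSU V)).re) -
        ekExpectationSU N b (fun V => (ekWord l (inclSU V)).re) * ekExpectationSU N b (fun V => (ekWord l' (inclSU V)).re))
      atTop (𝓝 0) := by
  set C := Real.sqrt ((∑ μ : Fin d, (wordMult l μ : ℝ) ^ 2) * (∑ μ : Fin d, (wordMult l' μ : ℝ) ^ 2)) with hC
  -- the bound `C/(N·K_N) = (C/N)/K_N` tends to zero
  have hlim : Tendsto (fun N : ℕ => C / (N * ((N : ℝ) / 2 - 8 * ((d : ℝ) - 1) * N * |b|))) atTop (𝓝 0) := by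
    refine (tendsto_wordVarBound hb C).congr' (Eventually.of_forall fun N => ?_)
    rw [div_div]
  rw [tendsto_zero_iff_abs_tendsto_zero]
  refine tendsto_of_tendsto_of_tendsto_of_le_of_le' tendsto_const_nhds hlim
    (Eventually.of_forall fun N => abs_nonneg _) ?_
  filter_upwards [eventually_gt_atTop 0] with N hN
  exact ek_factorisation_wordRe (Nat.pos_iff_ne_zero.1 hN) hb l l'

end Summit.QuantumFields.YangMills.Theorems.EguchiKawaiDirectionLadder
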